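import Literature.AlgebraicGeometry.HodgeTheory.FermatHodgeCharacterLocal
import Mathlib.Combinatorics.Enumerative.DoubleCounting
import HarnessLib

/-!
# Rigidity of short character relations (Aoki 1983, Cor. 3.4 and Props. 6.3–6.6, re-derived)

Support file III (everything PROVED; no named facts, no definitions) for the structure theorem of
the Hodge characters of the Fermat surface (`AokiShioda1983_thmB2m_standard`). Setting: a level
`q n` with `q, n` coprime (think `q = p^e ∥ m`), a divisor `d ∣ q`, `d ≠ q`, such that every
character mod `q` NOT factoring through `d` is primitive (e.g. `d = q/p`; for `q = p` prime,
`d = 1`), and a function `T : ℤ/(qn) → ℂ` (the coefficients of an element of Aoki's `R_{qn}`)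
which is ANNIHILATED: `∑ₓ T(x) χ(x) = 0` for every odd primitive character `χ` mod `qn` — the
output of `IsHodge.aoki_criterion`. Let `U = ker((ℤ/q)ˣ → (ℤ/d)ˣ)`.

* `sum_mul_prodChar_eq`: Fubini along the CRT decomposition,
  `∑ₓ T(x) (χ₁ ⊠ χ₂)(x) = ∑_a χ₁(a) F_{χ₂}(a)`, `F_{χ₂}(a) = ∑_b T(crt(a,b)) χ₂(b)` (the "slices").
* **Coarse rigidity** (`annihilated_restrict_class`, = [Aoki1983, Cor. 3.4]): the restriction of
  `T` to `{x : x mod q ∈ ±a₀U}` is again annihilated, for every unit `a₀` mod `q`. (For an odd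
  primitive `χ = χ₁ ⊠ χ₂` the local Fourier lemma makes the parity-`χ₁(-1)` part of `F_{χ₂}`
  `U`-invariant, hence killed by `χ₁`, which is non-trivial on `U`; the other parity part is
  killed by the symmetry `a ↦ -a` of the class.)
* **Fine rigidity** (`annihilated_restrict_pair`, = [Aoki1983, Prop. 6.4/6.6, "congruence
  property" `aᵢ ≡ ±a₁ (mod p^e)`]): if some `u ∈ U` has `±a₀u` outside the `q`-components of the
  support of `T` (a "free" element), the restriction of `T` to `{x : x mod q = ±a₀}` is annihilated.
  For `d = 1` (`q` prime) this is the pair-splitting behind Prop. 6.4 (i); the free element is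
  produced by counting (`exists_free_of_card_lt`, `exists_free_pair`) from `p > ℓ` resp.
  `p > ℓ + 1` with the weight lemma `two_le_weight_of_ne_zero` (no pair carries exactly one point
  of the support when an even primitive character mod `n` exists).

## References

* [Aoki1983] N. Aoki, On some arithmetic problems related to the Hodge cycles on the Fermat
  varieties, Math. Ann. 266 (1983) 23–54, Cor. 3.4, Props. 6.3–6.6, Lemma 7.2 (text read).
-/

noncomputable section

open Finset

namespace Literature.AlgebraicGeometry.HodgeTheory

namespace FermatCharacter

section Rigidity

variable {q n : ℕ} [NeZero q] [NeZero n]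

omit [NeZero q] [NeZero n] in
/-- The first CRT component is reduction mod `q`. [folklore] -/
private theorem crt_fst (h : q.Coprime n) (x : ZMod (q * n)) :
    (ZMod.chineseRemainder h x).1 = ZMod.castHom (dvd_mul_right q n) (ZMod q) x := by
  change ((ZMod.cast x : ZMod q × ZMod n)).1 = _
  rw [Prod.fst_zmod_cast, ZMod.castHom_apply]

omit [NeZero q] [NeZero n] in
/-- The second CRT component is reduction mod `n`. [folklore] -/
private theorem crt_snd (h : q.Coprime n) (x : ZMod (q * n)) :
    (ZMod.chineseRemainder h x).2 = ZMod.castHom (dvd_mul_left n q) (ZMod n) x := by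
  change ((ZMod.cast x : ZMod q × ZMod n)).2 = _
  rw [Prod.snd_zmod_cast, ZMod.castHom_apply]

omit [NeZero q] [NeZero n] in
/-- The components of `crt(a,b)`. [folklore] -/
private theorem castHom_crt_symm (h : q.Coprime n) (a : ZMod q) (b : ZMod n) :
    ZMod.castHom (dvd_mul_right q n) (ZMod q) ((ZMod.chineseRemainder h).symm (a, b)) = a ∧
    ZMod.castHom (dvd_mul_left n q) (ZMod n) ((ZMod.chineseRemainder h).symm (a, b)) = b := by
  constructor
  · rw [← crt_fst h, RingEquiv.apply_symm_apply]
  · rw [← crt_snd h, RingEquiv.apply_symm_apply]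

/-- **Fubini along the CRT decomposition** (the "slices" `F_{χ₂}(a) = ∑_b T(crt(a,b)) χ₂(b)`):
`∑ₓ T(x) (χ₁ ⊠ χ₂)(x) = ∑_a χ₁(a) F_{χ₂}(a)`. [folklore] -/
theorem sum_mul_prodChar_eq (h : q.Coprime n) (G : ZMod (q * n) → ℂ) (χ₁ : DirichletCharacter ℂ q)
    (χ₂ : DirichletCharacter ℂ n) :
    ∑ x : ZMod (q * n), G x * (DirichletCharacter.changeLevel (dvd_mul_right q n) χ₁ *
        DirichletCharacter.changeLevel (dvd_mul_left n q) χ₂) x =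
      ∑ a : ZMod q, χ₁ a * ∑ b : ZMod n, G ((ZMod.chineseRemainder h).symm (a, b)) * χ₂ b := by
  haveI : NeZero (q * n) := ⟨mul_ne_zero (NeZero.ne q) (NeZero.ne n)⟩
  rw [← Equiv.sum_comp (ZMod.chineseRemainder h).symm.toEquiv, Fintype.sum_prod_type]
  refine sum_congr rfl fun a _ ↦ ?_
  rw [Finset.mul_sum]
  refine sum_congr rfl fun b _ ↦ ?_
  rw [RingEquiv.toEquiv_eq_coe, EquivLike.coe_coe, prodChar_apply, (castHom_crt_symm h a b).1,
    (castHom_crt_symm h a b).2]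
  ring

/-- A character not factoring through `d` is non-trivial on some `u ≡ 1 (mod d)`. [folklore] -/
theorem exists_ker_apply_ne_one {d : ℕ} (hd : d ∣ q) {χ : DirichletCharacter ℂ q}
    (hχ : ¬ χ.FactorsThrough d) : ∃ u : (ZMod q)ˣ, ZMod.unitsMap hd u = 1 ∧ χ u ≠ 1 := by
  rw [DirichletCharacter.factorsThrough_iff_ker_unitsMap hd] at hχ
  by_contra hcon
  push Not at hcon
  exact hχ fun k hk ↦ by
    rw [MonoidHom.mem_ker] at hk ⊢
    ext
    rw [MulChar.coe_toUnitHom, Units.val_one]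
    exact hcon k hk

/-- A primitive character does not factor through a proper divisor. [folklore] -/
theorem not_factorsThrough_of_isPrimitive {d : ℕ} (hd : d ∣ q) (hdq : d ≠ q)
    {χ : DirichletCharacter ℂ q} (hχ : χ.IsPrimitive) : ¬ χ.FactorsThrough d := by
  intro hf
  have h1 := DirichletCharacter.conductor_dvd_of_mem_conductorSet χ
    ((DirichletCharacter.mem_conductorSet_iff _).mpr hf)
  rw [(DirichletCharacter.isPrimitive_def _).mp hχ] at h1
  exact hdq (Nat.dvd_antisymm hd h1)

open Classical in
/-- **Coarse rigidity** ([Aoki1983, Cor. 3.4]: "`c_a = 0` unless `a^{d'_p} ≡ 1 (mod p^{e_p})`").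
Let `T : ℤ/(qn) → ℂ` be annihilated by all odd primitive characters mod `qn`, where `d ∣ q`,
`d ≠ q`, and every character mod `q` not factoring through `d` is primitive. Then for every unit
`a₀` mod `q`, the restriction of `T` to the class `{x : x ≡ ±a₀u (mod q), u ≡ 1 (mod d)}` is
again annihilated. [cite: Aoki1983, Cor. 3.4 and Lemma 4.4] -/
theorem annihilated_restrict_class (h : q.Coprime n) {d : ℕ} (hd : d ∣ q) (hdq : d ≠ q)
    (hprim : ∀ χ : DirichletCharacter ℂ q, ¬ χ.FactorsThrough d → χ.IsPrimitive)
    (T : ZMod (q * n) → ℂ)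
    (hT : ∀ χ : DirichletCharacter ℂ (q * n), χ.Odd → χ.IsPrimitive →
      ∑ x : ZMod (q * n), T x * χ x = 0)
    (a₀ : (ZMod q)ˣ) (χ : DirichletCharacter ℂ (q * n)) (hodd : χ.Odd) (hχ : χ.IsPrimitive) :
    ∑ x : ZMod (q * n), (if ∃ u : (ZMod q)ˣ, ZMod.unitsMap hd u = 1 ∧
        (ZMod.castHom (dvd_mul_right q n) (ZMod q) x = a₀ * u ∨
          ZMod.castHom (dvd_mul_right q n) (ZMod q) x = -(a₀ * u)) then T x else 0) * χ x = 0 := by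
  haveI : NeZero (q * n) := ⟨mul_ne_zero (NeZero.ne q) (NeZero.ne n)⟩
  -- the class predicate on `ℤ/q`, symmetric and `U`-stable
  set P : ZMod q → Prop := fun a ↦ ∃ u : (ZMod q)ˣ, ZMod.unitsMap hd u = 1 ∧
    (a = a₀ * u ∨ a = -(a₀ * u)) with hP
  have hPneg : ∀ a, P (-a) ↔ P a := by
    intro a
    simp only [hP]
    constructor
    · rintro ⟨u, hu, h1 | h1⟩
      · exact ⟨u, hu, Or.inr (by rw [← h1, neg_neg])⟩
      · exact ⟨u, hu, Or.inl (by rw [← neg_neg (↑a₀ * ↑u : ZMod q), ← h1, neg_neg])⟩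
    · rintro ⟨u, hu, h1 | h1⟩
      · exact ⟨u, hu, Or.inr (by rw [h1])⟩
      · exact ⟨u, hu, Or.inl (by rw [h1, neg_neg])⟩
  have hPmul : ∀ (a : ZMod q) (u₁ : (ZMod q)ˣ), ZMod.unitsMap hd u₁ = 1 → (P (a * u₁) ↔ P a) := by
    intro a u₁ hu₁
    simp only [hP]
    constructor
    · rintro ⟨u, hu, h1 | h1⟩
      · refine ⟨u * u₁⁻¹, by rw [map_mul, map_inv, hu, hu₁, inv_one, mul_one], Or.inl ?_⟩
        rw [Units.val_mul, ← mul_assoc, ← h1, mul_assoc, Units.mul_inv, mul_one]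
      · refine ⟨u * u₁⁻¹, by rw [map_mul, map_inv, hu, hu₁, inv_one, mul_one], Or.inr ?_⟩
        rw [Units.val_mul, ← mul_assoc, ← neg_mul, ← h1, mul_assoc, Units.mul_inv, mul_one]
    · rintro ⟨u, hu, h1 | h1⟩
      · exact ⟨u * u₁, by rw [map_mul, hu, hu₁, mul_one], Or.inl (by rw [h1, Units.val_mul, mul_assoc])⟩
      · exact ⟨u * u₁, by rw [map_mul, hu, hu₁, mul_one], Or.inr (by rw [h1, Units.val_mul, neg_mul, mul_assoc])⟩
  -- decompose `χ`
  obtain ⟨χ₁, χ₂, rfl, hprims⟩ := exists_eq_prodChar h χ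
  obtain ⟨h1prim, h2prim⟩ := hprims hχ
  set ε : ℂ := χ₁ (-1) with hε
  have hε1 : ε = 1 ∨ ε = -1 := char_neg_one_eq_or χ₁
  have hεsq : ε * ε = 1 := by rcases hε1 with h1 | h1 <;> rw [h1] <;> norm_num
  -- the slices of `T`
  set F : ZMod q → ℂ := fun a ↦ ∑ b : ZMod n, T ((ZMod.chineseRemainder h).symm (a, b)) * χ₂ b
    with hF
  -- `F` is orthogonal to all `χ₁'` of parity `ε` not factoring through `d`
  have horth : ∀ χ₁' : DirichletCharacter ℂ q, χ₁' (-1) = ε → ¬ χ₁'.FactorsThrough d →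
      ∑ a : ZMod q, F a * χ₁' a = 0 := by
    intro χ₁' hpar hnf
    have hodd' : (DirichletCharacter.changeLevel (dvd_mul_right q n) χ₁' *
        DirichletCharacter.changeLevel (dvd_mul_left n q) χ₂).Odd := by
      rw [DirichletCharacter.Odd, prodChar_neg_one, hpar, hε, ← prodChar_neg_one]
      exact hodd
    have := hT _ hodd' (prodChar_isPrimitive h (hprim χ₁' hnf) h2prim)
    rw [sum_mul_prodChar_eq h] at this
    rw [← this]
    exact sum_congr rfl fun a _ ↦ mul_comm _ _
  -- Fubini for the restricted function
  rw [sum_mul_prodChar_eq h]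
  have hslice : ∀ a : ZMod q, ∑ b : ZMod n, (if ∃ u : (ZMod q)ˣ, ZMod.unitsMap hd u = 1 ∧
      (ZMod.castHom (dvd_mul_right q n) (ZMod q) ((ZMod.chineseRemainder h).symm (a, b)) = a₀ * u ∨
        ZMod.castHom (dvd_mul_right q n) (ZMod q) ((ZMod.chineseRemainder h).symm (a, b)) =
          -(a₀ * u)) then T ((ZMod.chineseRemainder h).symm (a, b)) else 0) * χ₂ b =
      if P a then F a else 0 := by
    intro a
    simp only [(castHom_crt_symm h a _).1]
    by_cases ha : P a
    · rw [if_pos ha]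
      refine sum_congr rfl fun b _ ↦ ?_
      rw [if_pos ha]
    · rw [if_neg ha]
      refine sum_eq_zero fun b _ ↦ ?_
      rw [if_neg ha, zero_mul]
  simp_rw [hslice]
  -- split `F` into its two parity parts
  set G : ZMod q → ℂ := fun a ↦ F a + ε * F (-a) with hG
  set G' : ZMod q → ℂ := fun a ↦ F a - ε * F (-a) with hG'
  have hFGG : ∀ a, F a = (G a + G' a) / 2 := by intro a; simp only [hG, hG']; ring
  -- `U`-invariance of `G` on units (local Fourier lemma)
  have hGinv : ∀ (u y : (ZMod q)ˣ), ZMod.unitsMap hd u = 1 → G ((u : ZMod q) * y) = G y := by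
    intro u y hu
    exact parityPart_mul_eq_of_orthogonal hd F hε1 horth u y hu
  -- the `G'`-part vanishes by the symmetry `a ↦ -a`
  have hS2 : ∑ a : ZMod q, χ₁ a * (if P a then G' a else 0) = 0 := by
    have hneg : ∑ a : ZMod q, χ₁ a * (if P a then G' a else 0) =
        -∑ a : ZMod q, χ₁ a * (if P a then G' a else 0) := by
      conv_lhs => rw [← Equiv.sum_comp (Equiv.neg (ZMod q))]
      rw [← sum_neg_distrib]
      refine sum_congr rfl fun a _ ↦ ?_
      simp only [Equiv.neg_apply]
      rw [if_congr (hPneg a) rfl rfl]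
      by_cases ha : P a
      · rw [if_pos ha, if_pos ha]
        have h1 : χ₁ (-a) = ε * χ₁ a := by rw [hε, ← map_mul, neg_one_mul]
        have h2 : G' (-a) = -ε * G' a := by
          simp only [hG', neg_neg]
          linear_combination (-(F (-a))) * hεsq
        rw [h1, h2]
        simp only [hG']
        linear_combination (-(χ₁ a * F a) + ε * (χ₁ a * F (-a))) * hεsq
      · rw [if_neg ha, if_neg ha, mul_zero, mul_zero, neg_zero]
    linear_combination hneg / 2
  -- the `G`-part vanishes by `U`-invariance and non-triviality of `χ₁` on `U`
  have hS1 : ∑ a : ZMod q, χ₁ a * (if P a then G a else 0) = 0 := by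
    obtain ⟨u₁, hu₁, hχu⟩ := exists_ker_apply_ne_one hd
      (not_factorsThrough_of_isPrimitive hd hdq h1prim)
    have hmul : ∑ a : ZMod q, χ₁ a * (if P a then G a else 0) =
        χ₁ u₁ * ∑ a : ZMod q, χ₁ a * (if P a then G a else 0) := by
      conv_lhs => rw [← Equiv.sum_comp u₁.mulRight]
      rw [Finset.mul_sum]
      refine sum_congr rfl fun a _ ↦ ?_
      simp only [Units.mulRight_apply]
      rw [if_congr (hPmul a u₁ hu₁) rfl rfl, map_mul]
      by_cases ha : P a
      · rw [if_pos ha, if_pos ha]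
        by_cases hau : IsUnit a
        · rw [← hau.unit_spec, mul_comm (hau.unit : ZMod q) (u₁ : ZMod q), hGinv u₁ hau.unit hu₁]
          ring
        · rw [MulChar.map_nonunit χ₁ hau, zero_mul, zero_mul, zero_mul, mul_zero]
      · rw [if_neg ha, if_neg ha, mul_zero, mul_zero, mul_zero]
    have : (1 - χ₁ u₁) * ∑ a : ZMod q, χ₁ a * (if P a then G a else 0) = 0 := by
      rw [sub_mul, one_mul, ← hmul, sub_self]
    exact (mul_eq_zero.mp this).resolve_left (sub_ne_zero.mpr (Ne.symm hχu))
  -- assemble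
  have hsplit : ∀ a : ZMod q, χ₁ a * (if P a then F a else 0) =
      (χ₁ a * (if P a then G a else 0) + χ₁ a * (if P a then G' a else 0)) / 2 := by
    intro a
    by_cases ha : P a
    · rw [if_pos ha, if_pos ha, if_pos ha, hFGG a]; ring
    · rw [if_neg ha, if_neg ha, if_neg ha]; ring
  rw [sum_congr rfl fun a _ ↦ hsplit a, ← sum_div, sum_add_distrib, hS1, hS2, add_zero, zero_div]

open Classical in
/-- **Fine rigidity** ([Aoki1983, Prop. 6.4 / 6.6]: the congruence property
`aᵢ ≡ ±a₁ (mod p^e)`). In the setting of `annihilated_restrict_class`, suppose `2 < q` and that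
some `u ≡ 1 (mod d)` is FREE for the unit `a₀`: no point `x` with `T(x) ≠ 0` reduces to `±a₀u`
mod `q`. Then the restriction of `T` to the pair `{x : x ≡ ±a₀ (mod q)}` is annihilated. (The
pair sum is `χ₁(a₀) G(a₀)` with `G` the parity-`χ₁(-1)` part of the slice `F_{χ₂}`, and
`G(a₀) = G(a₀u) = 0`.) For `d = 1` (`q` prime) the free element is a free pair `±a₁`.
[cite: Aoki1983, Prop. 6.4 and Prop. 6.6] -/
theorem annihilated_restrict_pair (h : q.Coprime n) (hq2 : 2 < q) {d : ℕ} (hd : d ∣ q)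
    (hprim : ∀ χ : DirichletCharacter ℂ q, ¬ χ.FactorsThrough d → χ.IsPrimitive)
    (T : ZMod (q * n) → ℂ)
    (hT : ∀ χ : DirichletCharacter ℂ (q * n), χ.Odd → χ.IsPrimitive →
      ∑ x : ZMod (q * n), T x * χ x = 0)
    (a₀ : (ZMod q)ˣ) (u : (ZMod q)ˣ) (hu : ZMod.unitsMap hd u = 1)
    (hfree : ∀ x : ZMod (q * n), T x ≠ 0 →
      ZMod.castHom (dvd_mul_right q n) (ZMod q) x ≠ a₀ * u ∧
        ZMod.castHom (dvd_mul_right q n) (ZMod q) x ≠ -(a₀ * u))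
    (χ : DirichletCharacter ℂ (q * n)) (hodd : χ.Odd) (hχ : χ.IsPrimitive) :
    ∑ x : ZMod (q * n), (if ZMod.castHom (dvd_mul_right q n) (ZMod q) x = a₀ ∨
        ZMod.castHom (dvd_mul_right q n) (ZMod q) x = -a₀ then T x else 0) * χ x = 0 := by
  haveI : NeZero (q * n) := ⟨mul_ne_zero (NeZero.ne q) (NeZero.ne n)⟩
  -- `a₀ ≠ -a₀` since `q > 2`
  have hne : (a₀ : ZMod q) ≠ -a₀ := by
    intro heq
    have h2 : (2 : ZMod q) * a₀ = 0 := by rw [two_mul]; nth_rewrite 2 [heq]; rw [add_neg_cancel]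
    have h2' : (2 : ZMod q) = 0 := by
      have := congrArg (· * ((a₀⁻¹ : (ZMod q)ˣ) : ZMod q)) h2
      simpa [mul_assoc] using this
    have : (q : ℕ) ∣ 2 := by
      rw [show (2 : ZMod q) = ((2 : ℕ) : ZMod q) by norm_cast] at h2'
      exact (ZMod.natCast_eq_zero_iff 2 q).mp h2'
    exact absurd (Nat.le_of_dvd two_pos this) (not_le.mpr hq2)
  obtain ⟨χ₁, χ₂, rfl, hprims⟩ := exists_eq_prodChar h χ
  obtain ⟨h1prim, h2prim⟩ := hprims hχ
  set ε : ℂ := χ₁ (-1) with hε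
  have hε1 : ε = 1 ∨ ε = -1 := char_neg_one_eq_or χ₁
  set F : ZMod q → ℂ := fun a ↦ ∑ b : ZMod n, T ((ZMod.chineseRemainder h).symm (a, b)) * χ₂ b
    with hF
  have horth : ∀ χ₁' : DirichletCharacter ℂ q, χ₁' (-1) = ε → ¬ χ₁'.FactorsThrough d →
      ∑ a : ZMod q, F a * χ₁' a = 0 := by
    intro χ₁' hpar hnf
    have hodd' : (DirichletCharacter.changeLevel (dvd_mul_right q n) χ₁' *
        DirichletCharacter.changeLevel (dvd_mul_left n q) χ₂).Odd := by
      rw [DirichletCharacter.Odd, prodChar_neg_one, hpar, hε, ← prodChar_neg_one]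
      exact hodd
    have := hT _ hodd' (prodChar_isPrimitive h (hprim χ₁' hnf) h2prim)
    rw [sum_mul_prodChar_eq h] at this
    rw [← this]
    exact sum_congr rfl fun a _ ↦ mul_comm _ _
  -- the slice vanishes at `±a₀u`
  have hFzero : ∀ a : ZMod q, (a = a₀ * u ∨ a = -(a₀ * u)) → F a = 0 := by
    intro a ha
    refine sum_eq_zero fun b _ ↦ ?_
    by_cases hTb : T ((ZMod.chineseRemainder h).symm (a, b)) = 0
    · rw [hTb, zero_mul]
    · exfalso
      obtain ⟨h1, h2⟩ := hfree _ hTb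
      rw [(castHom_crt_symm h a b).1] at h1 h2
      rcases ha with ha | ha
      · exact h1 ha
      · exact h2 ha
  -- Fubini for the restricted function
  rw [sum_mul_prodChar_eq h]
  have hslice : ∀ a : ZMod q, ∑ b : ZMod n,
      (if ZMod.castHom (dvd_mul_right q n) (ZMod q) ((ZMod.chineseRemainder h).symm (a, b)) = a₀ ∨
          ZMod.castHom (dvd_mul_right q n) (ZMod q) ((ZMod.chineseRemainder h).symm (a, b)) = -a₀
        then T ((ZMod.chineseRemainder h).symm (a, b)) else 0) * χ₂ b =
      if (a = a₀ ∨ a = -a₀) then F a else 0 := by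
    intro a
    simp only [(castHom_crt_symm h a _).1]
    by_cases ha : a = a₀ ∨ a = -a₀
    · rw [if_pos ha]
      refine sum_congr rfl fun b _ ↦ ?_
      rw [if_pos ha]
    · rw [if_neg ha]
      refine sum_eq_zero fun b _ ↦ ?_
      rw [if_neg ha, zero_mul]
  simp_rw [hslice]
  -- only `a = ±a₀` contribute
  have hsum : ∑ a : ZMod q, χ₁ a * (if (a = a₀ ∨ a = -a₀) then F a else 0) =
      χ₁ a₀ * (F a₀ + ε * F (-a₀)) := by
    rw [← Finset.sum_subset (Finset.subset_univ ({(a₀ : ZMod q), -(a₀ : ZMod q)} : Finset (ZMod q)))]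
    · rw [Finset.sum_pair hne, if_pos (Or.inl rfl), if_pos (Or.inr rfl)]
      have h1 : χ₁ (-(a₀ : ZMod q)) = ε * χ₁ a₀ := by rw [hε, ← map_mul, neg_one_mul]
      rw [h1]
      ring
    · intro a _ ha
      rw [Finset.mem_insert, Finset.mem_singleton] at ha
      rw [if_neg ha, mul_zero]
  rw [hsum]
  -- `G(a₀) = G(u a₀) = 0`
  have hG := parityPart_mul_eq_of_orthogonal hd F hε1 horth u a₀ hu
  rw [← hG, mul_comm (u : ZMod q) (a₀ : ZMod q), hFzero _ (Or.inl rfl)]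
  rw [show -((a₀ : ZMod q) * u) = -((a₀ : ZMod q) * u) from rfl, hFzero _ (Or.inr rfl)]
  ring

/-! ### Producing free elements by counting -/

omit [NeZero n] in
/-- **Free element in a coset of `U = ker((ℤ/q)ˣ → (ℤ/d)ˣ)`** when `-1 ∉ U`: if a finite set
`S ⊂ ℤ/(qn)` (the support) has fewer elements than `U`, then for every unit `a₀` some `u ∈ U`
has `±a₀u` outside the mod-`q` reductions of `S` (each `x ∈ S` blocks at most one `u`).
[cite: Aoki1983, Prop. 6.4 (ii) (proof)] -/
theorem exists_free_of_card_lt {d : ℕ} (hd : d ∣ q) (hm1 : ZMod.unitsMap hd (-1) ≠ 1)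
    (S : Finset (ZMod (q * n))) (a₀ : (ZMod q)ˣ)
    (hcard : #S < #(univ.filter fun u : (ZMod q)ˣ ↦ ZMod.unitsMap hd u = 1)) :
    ∃ u : (ZMod q)ˣ, ZMod.unitsMap hd u = 1 ∧ ∀ x ∈ S,
      ZMod.castHom (dvd_mul_right q n) (ZMod q) x ≠ a₀ * u ∧
        ZMod.castHom (dvd_mul_right q n) (ZMod q) x ≠ -(a₀ * u) := by
  classical
  set Uf : Finset (ZMod q)ˣ := univ.filter fun u : (ZMod q)ˣ ↦ ZMod.unitsMap hd u = 1 with hUf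
  set fib : ZMod (q * n) → Finset (ZMod q)ˣ := fun x ↦ Uf.filter fun u ↦
    ZMod.castHom (dvd_mul_right q n) (ZMod q) x = a₀ * u ∨
      ZMod.castHom (dvd_mul_right q n) (ZMod q) x = -(a₀ * u) with hfib
  set Bad : Finset (ZMod q)ˣ := S.biUnion fib with hBad
  -- two units in the same fibre are equal (else `-1 ∈ U`)
  have hinj : ∀ (x : ZMod (q * n)) (u u' : (ZMod q)ˣ), u ∈ fib x → u' ∈ fib x → u = u' := by
    intro x u u' hu hu'
    simp only [hfib, hUf, mem_filter, mem_univ, true_and] at hu hu'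
    have key : ∀ v v' : (ZMod q)ˣ, ZMod.unitsMap hd v = 1 → ZMod.unitsMap hd v' = 1 →
        (a₀ : ZMod q) * v = -((a₀ : ZMod q) * v') → False := by
      intro v v' hv hv' heq
      apply hm1
      have h1 : (-1 : (ZMod q)ˣ) = v * v'⁻¹ := by
        rw [eq_mul_inv_iff_mul_eq]
        ext
        rw [Units.val_mul, Units.val_neg, Units.val_one, neg_one_mul]
        have := congrArg (fun z ↦ ((a₀⁻¹ : (ZMod q)ˣ) : ZMod q) * z) heq
        simp only [← mul_assoc, Units.inv_mul, one_mul, mul_neg] at this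
        rw [this]
      rw [h1, map_mul, map_inv, hv, hv', inv_one, mul_one]
    rcases hu.2 with h1 | h1 <;> rcases hu'.2 with h2 | h2
    · rw [h1] at h2
      exact Units.ext ((Units.mul_right_inj a₀).mp h2)
    · exact (key u u' hu.1 hu'.1 (h1 ▸ h2)).elim
    · exact (key u' u hu'.1 hu.1 (h2 ▸ h1)).elim
    · rw [h1, neg_inj] at h2
      exact Units.ext ((Units.mul_right_inj a₀).mp h2)
  have hBadcard : #Bad ≤ #S := by
    calc #Bad ≤ ∑ x ∈ S, #(fib x) := Finset.card_biUnion_le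
      _ ≤ ∑ x ∈ S, 1 := Finset.sum_le_sum fun x _ ↦ Finset.card_le_one.mpr
          (fun u hu u' hu' ↦ hinj x u u' hu hu')
      _ = #S := by rw [Finset.sum_const, smul_eq_mul, mul_one]
  have hlt : #Bad < #Uf := lt_of_le_of_lt hBadcard hcard
  obtain ⟨u, huU, huB⟩ := Finset.exists_mem_notMem_of_card_lt_card hlt
  refine ⟨u, (mem_filter.mp huU).2, fun x hx ↦ ?_⟩
  have hxu : u ∉ fib x := fun hmem ↦ huB (Finset.mem_biUnion.mpr ⟨x, hx, hmem⟩)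
  simp only [hfib, mem_filter, not_and, not_or] at hxu
  exact hxu huU

omit [NeZero q] in
/-- `(ℤ/1)ˣ` is trivial: every unit of `ℤ/q` lies in the kernel to level `1`. [folklore] -/
theorem unitsMap_one_dvd (u : (ZMod q)ˣ) : ZMod.unitsMap (one_dvd q) u = 1 :=
  haveI : Subsingleton (ZMod 1) := ZMod.subsingleton_iff.mpr rfl
  Subsingleton.elim _ _

/-- **Weight lemma** (no pair carries exactly one point). Let `q > 2` be such that every
non-trivial character mod `q` is primitive (`q` prime), assume an EVEN primitive character mod
`n` exists, and let `T` be supported on units and annihilated by all odd primitive characters mod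
`qn`. If `T(x₀) ≠ 0` then some other point `x₁ ≠ x₀` of the support reduces to `±x₀` mod `q`.
(Otherwise the slice `F_{χ₂}` of an even primitive `χ₂` — an even function by the local Fourier
lemma — has `F(x₀ mod q) = T(x₀) χ₂(x₀ mod n) ≠ 0 = F(-x₀ mod q)`.)
[cite: Aoki1983, Prop. 6.4 (i) (proof: "`ℓ(fᵢ) ≤ 1` … `fᵢ` must be zero")] -/
theorem exists_second_point (h : q.Coprime n) (hq2 : 2 < q)
    (hprim : ∀ χ : DirichletCharacter ℂ q, ¬ χ.FactorsThrough 1 → χ.IsPrimitive)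
    (hPC : ∃ χ₂ : DirichletCharacter ℂ n, χ₂.Even ∧ χ₂.IsPrimitive)
    (T : ZMod (q * n) → ℂ) (hTu : ∀ x, ¬ IsUnit x → T x = 0)
    (hT : ∀ χ : DirichletCharacter ℂ (q * n), χ.Odd → χ.IsPrimitive →
      ∑ x : ZMod (q * n), T x * χ x = 0)
    {x₀ : ZMod (q * n)} (hx₀ : T x₀ ≠ 0) :
    ∃ x₁ : ZMod (q * n), x₁ ≠ x₀ ∧ T x₁ ≠ 0 ∧
      (ZMod.castHom (dvd_mul_right q n) (ZMod q) x₁ = ZMod.castHom (dvd_mul_right q n) (ZMod q) x₀ ∨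
        ZMod.castHom (dvd_mul_right q n) (ZMod q) x₁ =
          -ZMod.castHom (dvd_mul_right q n) (ZMod q) x₀) := by
  classical
  haveI : NeZero (q * n) := ⟨mul_ne_zero (NeZero.ne q) (NeZero.ne n)⟩
  by_contra hcon
  push Not at hcon
  set e := ZMod.chineseRemainder h with he
  set a : ZMod q := ZMod.castHom (dvd_mul_right q n) (ZMod q) x₀ with ha
  set b₀ : ZMod n := ZMod.castHom (dvd_mul_left n q) (ZMod n) x₀ with hb₀
  have hx₀u : IsUnit x₀ := by
    by_contra hnu
    exact hx₀ (hTu x₀ hnu)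
  obtain ⟨hau, hb₀u⟩ := (isUnit_iff_of_coprime x₀).mp hx₀u
  have hex₀ : e x₀ = (a, b₀) := Prod.ext (crt_fst h x₀) (crt_snd h x₀)
  have hx₀e : x₀ = e.symm (a, b₀) := by rw [← hex₀, RingEquiv.symm_apply_apply]
  -- `a ≠ -a`
  have hane : a ≠ -a := by
    intro heq
    have h2 : (2 : ZMod q) * a = 0 := by rw [two_mul]; nth_rewrite 2 [heq]; rw [add_neg_cancel]
    have h2' : (2 : ZMod q) = 0 := by
      have hinv : a * ((hau.unit⁻¹ : (ZMod q)ˣ) : ZMod q) = 1 := hau.mul_val_inv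
      calc (2 : ZMod q) = 2 * (a * ((hau.unit⁻¹ : (ZMod q)ˣ) : ZMod q)) := by rw [hinv, mul_one]
        _ = 2 * a * ((hau.unit⁻¹ : (ZMod q)ˣ) : ZMod q) := by rw [mul_assoc]
        _ = 0 := by rw [h2, zero_mul]
    have : (q : ℕ) ∣ 2 := by
      rw [show (2 : ZMod q) = ((2 : ℕ) : ZMod q) by norm_cast] at h2'
      exact (ZMod.natCast_eq_zero_iff 2 q).mp h2'
    exact absurd (Nat.le_of_dvd two_pos this) (not_le.mpr hq2)
  obtain ⟨χ₂, h2even, h2prim⟩ := hPC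
  set F : ZMod q → ℂ := fun c ↦ ∑ b : ZMod n, T (e.symm (c, b)) * χ₂ b with hF
  have horth : ∀ χ₁ : DirichletCharacter ℂ q, χ₁ (-1) = -1 → ¬ χ₁.FactorsThrough 1 →
      ∑ c : ZMod q, F c * χ₁ c = 0 := by
    intro χ₁ hpar hnf
    have := hT _ (prodChar_odd_of_odd_even hpar h2even)
      (prodChar_isPrimitive h (hprim χ₁ hnf) h2prim)
    rw [sum_mul_prodChar_eq h] at this
    rw [← this]
    exact sum_congr rfl fun c _ ↦ mul_comm _ _
  -- `F` is even at `a`: apply the local lemma with `u = -1`, `d = 1`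
  have hloc := parityPart_mul_eq_of_orthogonal (one_dvd q) F (Or.inr rfl) horth (-1) hau.unit
    (unitsMap_one_dvd (-1))
  simp only [Units.val_neg, Units.val_one, IsUnit.unit_spec, neg_one_mul, neg_neg] at hloc
  -- hloc : F (-a) + -1 * F a = F a + -1 * F (-a)
  have heven : F a = F (-a) := by linear_combination -(hloc / 2)
  -- `F a = T x₀ χ₂ b₀`
  have hFa : F a = T x₀ * χ₂ b₀ := by
    simp only [hF]
    rw [Finset.sum_eq_single b₀]
    · rw [← hx₀e]
    · intro b _ hb
      have hne : e.symm (a, b) ≠ x₀ := by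
        intro heq
        apply hb
        have := congrArg (fun z ↦ (e z).2) heq
        simpa [hex₀] using this
      by_cases hTb : T (e.symm (a, b)) = 0
      · rw [hTb, zero_mul]
      · exact absurd (castHom_crt_symm h a b).1 (hcon _ hne hTb).1
    · intro hb; exact absurd (mem_univ b₀) hb
  -- `F (-a) = 0`
  have hFna : F (-a) = 0 := by
    simp only [hF]
    refine sum_eq_zero fun b _ ↦ ?_
    have hne : e.symm (-a, b) ≠ x₀ := by
      intro heq
      have := congrArg (fun z ↦ (e z).1) heq
      simp only [RingEquiv.apply_symm_apply, hex₀] at this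
      exact hane this.symm
    by_cases hTb : T (e.symm (-a, b)) = 0
    · rw [hTb, zero_mul]
    · exact absurd (castHom_crt_symm h (-a) b).1 (hcon _ hne hTb).2
  rw [hFa, hFna] at heven
  have hχb : χ₂ b₀ = 0 := (mul_eq_zero.mp heven).resolve_left hx₀
  exact (hb₀u.map χ₂).ne_zero hχb

/-- **Free pair** ([Aoki1983, Prop. 6.4 (i)]: `p > ℓ + 1`). In the setting of the weight lemma,
if the support of `T` has fewer than `φ(q)` points, some unit `a₁` mod `q` has no point of the
support over `±a₁`. (Double counting: each support point lies over exactly two units `±(x mod q)`,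
and a unit carrying a point carries at least two.) [cite: Aoki1983, Prop. 6.4 (i)] -/
theorem exists_free_pair (h : q.Coprime n) (hq2 : 2 < q)
    (hprim : ∀ χ : DirichletCharacter ℂ q, ¬ χ.FactorsThrough 1 → χ.IsPrimitive)
    (hPC : ∃ χ₂ : DirichletCharacter ℂ n, χ₂.Even ∧ χ₂.IsPrimitive)
    (T : ZMod (q * n) → ℂ) (hTu : ∀ x, ¬ IsUnit x → T x = 0)
    (hT : ∀ χ : DirichletCharacter ℂ (q * n), χ.Odd → χ.IsPrimitive →
      ∑ x : ZMod (q * n), T x * χ x = 0)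
    (hcard : #(univ.filter fun x : ZMod (q * n) ↦ T x ≠ 0) < #(univ.filter fun a : ZMod q ↦ IsUnit a)) :
    ∃ a₁ : (ZMod q)ˣ, ∀ x : ZMod (q * n), T x ≠ 0 →
      ZMod.castHom (dvd_mul_right q n) (ZMod q) x ≠ a₁ ∧
        ZMod.castHom (dvd_mul_right q n) (ZMod q) x ≠ -a₁ := by
  classical
  haveI : NeZero (q * n) := ⟨mul_ne_zero (NeZero.ne q) (NeZero.ne n)⟩
  set S : Finset (ZMod (q * n)) := univ.filter fun x ↦ T x ≠ 0 with hS
  set A : Finset (ZMod q) := univ.filter fun a : ZMod q ↦ IsUnit a with hA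
  set r : ZMod q → ZMod (q * n) → Prop := fun a x ↦
    ZMod.castHom (dvd_mul_right q n) (ZMod q) x = a ∨
      ZMod.castHom (dvd_mul_right q n) (ZMod q) x = -a with hr
  have hdc := Finset.sum_card_bipartiteAbove_eq_sum_card_bipartiteBelow (s := A) (t := S) r
  -- every support point lies over exactly two units
  have htwo : ∀ x ∈ S, #(A.bipartiteBelow r x) = 2 := by
    intro x hx
    have hxu : IsUnit x := by
      by_contra hnu
      exact (mem_filter.mp hx).2 (hTu x hnu)
    have hcu : IsUnit (ZMod.castHom (dvd_mul_right q n) (ZMod q) x) := hxu.map _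
    have hne : ZMod.castHom (dvd_mul_right q n) (ZMod q) x ≠
        -ZMod.castHom (dvd_mul_right q n) (ZMod q) x := by
      intro heq
      set c := ZMod.castHom (dvd_mul_right q n) (ZMod q) x
      have h2 : (2 : ZMod q) * c = 0 := by rw [two_mul]; nth_rewrite 2 [heq]; rw [add_neg_cancel]
      have h2' : (2 : ZMod q) = 0 := by
        have hinv : c * ((hcu.unit⁻¹ : (ZMod q)ˣ) : ZMod q) = 1 := hcu.mul_val_inv
        calc (2 : ZMod q) = 2 * (c * ((hcu.unit⁻¹ : (ZMod q)ˣ) : ZMod q)) := by rw [hinv, mul_one]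
          _ = 2 * c * ((hcu.unit⁻¹ : (ZMod q)ˣ) : ZMod q) := by rw [mul_assoc]
          _ = 0 := by rw [h2, zero_mul]
      have : (q : ℕ) ∣ 2 := by
        rw [show (2 : ZMod q) = ((2 : ℕ) : ZMod q) by norm_cast] at h2'
        exact (ZMod.natCast_eq_zero_iff 2 q).mp h2'
      exact absurd (Nat.le_of_dvd two_pos this) (not_le.mpr hq2)
    have hset : A.bipartiteBelow r x = {ZMod.castHom (dvd_mul_right q n) (ZMod q) x,
        -ZMod.castHom (dvd_mul_right q n) (ZMod q) x} := by
      ext a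
      rw [Finset.mem_bipartiteBelow, mem_insert, mem_singleton]
      simp only [hA, hr, mem_filter, mem_univ, true_and]
      constructor
      · rintro ⟨-, h1 | h1⟩
        · exact Or.inl h1.symm
        · exact Or.inr (by rw [h1, neg_neg])
      · rintro (rfl | rfl)
        · exact ⟨hcu, Or.inl rfl⟩
        · exact ⟨hcu.neg, Or.inr (by rw [neg_neg])⟩
    rw [hset, card_pair hne]
  rw [Finset.sum_congr rfl htwo, sum_const, smul_eq_mul] at hdc
  -- a unit carrying a point carries at least two
  set Bad : Finset (ZMod q) := A.filter fun a ↦ (S.bipartiteAbove r a).Nonempty with hBad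
  have hge : ∀ a ∈ Bad, 2 ≤ #(S.bipartiteAbove r a) := by
    intro a ha
    obtain ⟨x₀, hx₀mem⟩ := (mem_filter.mp ha).2
    have hx₀ := (Finset.mem_bipartiteAbove _).mp hx₀mem
    have hT0 : T x₀ ≠ 0 := (mem_filter.mp hx₀.1).2
    obtain ⟨x₁, hne, hT1, hred⟩ := exists_second_point h hq2 hprim hPC T hTu hT hT0
    have hx₁ : x₁ ∈ S.bipartiteAbove r a := by
      rw [Finset.mem_bipartiteAbove]
      refine ⟨mem_filter.mpr ⟨mem_univ _, hT1⟩, ?_⟩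
      simp only [hr] at hx₀ ⊢
      rcases hx₀.2 with h0 | h0 <;> rcases hred with h1 | h1
      · exact Or.inl (h1.trans h0)
      · exact Or.inr (by rw [h1, h0])
      · exact Or.inr (h1.trans h0)
      · exact Or.inl (by rw [h1, h0, neg_neg])
    exact Finset.one_lt_card.mpr ⟨x₁, hx₁, x₀, hx₀mem, hne⟩
  have hBad : #Bad ≤ #S := by
    have h1 : #Bad • 2 ≤ ∑ a ∈ Bad, #(S.bipartiteAbove r a) := Finset.card_nsmul_le_sum _ _ _ hge
    have h2 : ∑ a ∈ Bad, #(S.bipartiteAbove r a) ≤ ∑ a ∈ A, #(S.bipartiteAbove r a) :=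
      Finset.sum_le_sum_of_subset (filter_subset _ _)
    have h3 := h1.trans h2
    rw [hdc, smul_eq_mul] at h3
    exact Nat.le_of_mul_le_mul_right h3 two_pos
  obtain ⟨a₁, haA, haB⟩ := Finset.exists_mem_notMem_of_card_lt_card (lt_of_le_of_lt hBad hcard)
  have ha₁ : IsUnit a₁ := (mem_filter.mp haA).2
  have hempty : ∀ x ∈ S, ¬ r a₁ x := by
    intro x hx hrx
    exact haB (mem_filter.mpr ⟨haA, ⟨x, (Finset.mem_bipartiteAbove _).mpr ⟨hx, hrx⟩⟩⟩)
  refine ⟨ha₁.unit, fun x hx ↦ ?_⟩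
  have := hempty x (mem_filter.mpr ⟨mem_univ _, hx⟩)
  simp only [hr, not_or, IsUnit.unit_spec] at this ⊢
  exact this


end Rigidity

end FermatCharacter

end Literature.AlgebraicGeometry.HodgeTheory
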